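import Mathlib
import Literature.MathematicalPhysics.QuantumFieldTheory.Dimock2011to13.MultiRegionFreeFlow

/-!
# Dimock, *The renormalization group according to Balaban* II, §2.3 "free flow – single step": the one-step
# minimization in `Φ_{k,Ω_{k+1}}` ((cherry0)/(psik)/(stringy2) = I (kingmaker0)–(fifty)), LEMMA 2.3 (the joint minimizer
# `φ⁰_{k+1,Ω⁺}`, `Ψ_{k,Ω_{k+1}}(Ω⁺)`, the identity (loopy), the value (nono)) and the EXPANSION (expand)/(worry) whose
# quadratic form is `[Δ_{k,Ω} + (a/L²)QᵀQ]_{Ω_{k+1}}` = the inverse fluctuation covariance of App. C — PROVED as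
# finite-dimensional linear algebra

**Citation header (reproduction of PUBLISHED work; template of the Balaban lattice Yang–Mills cell).**
J. Dimock, *The renormalization group according to Balaban. II. Large fields*, J. Math. Phys. **54** (2013) 092301
(= arXiv:1212.5562v2) [Dimock2013BalabanII]: §2.1 (cherry0)–(stringy2) (TeX L509–531), §2.3 "free flow – single step"
(L712–925): the functional `J_{Ω⁺}` (thefirst) L716–729, Lemma 2.3 (`\label{otto1}`, L739–793; = Lemma 2.3 of the
printed numbering, TEMPLATE.md §9) with its proof (L796–867), the expansion (expand)/(worry) (L871–909) and the Gaussian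
(cloudy3) (L911–918).  J. Dimock, *The renormalization group according to Balaban. I. Small fields*, Rev. Math. Phys.
**25** (2013) 1330010 (= arXiv:1108.1335v2) [Dimock2013]: §2.2, proof of Lemma 2 (`\label{second}`), (kingmaker0)
L470–490, (potpie) L492–506, (tee)/(ak)/(tea)/(fifty) L507–536.  TeX line numbers refer to the arXiv sources held by
the cell (`inputs/files/dimock/src/1212.5562/1212.5562.tex`, 7217 lines; `inputs/files/dimock/src/1108.1335/1108.1335.tex`,
4263 lines).

**What the papers print (verbatim).**  [Dimock2013BalabanII] L509–531: *"To evaluate the integral over Φ_{k,Ω_{k+1}}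
we expand around the minimizer in Φ_{k,Ω_{k+1}} of (a/2L²)‖Φ_{k+1} − QΦ_k‖²_{Ω_{k+1}} + (a_k/2)‖Φ_k − Q_kφ‖²_{Ω_{k+1}}
(stringy).  This is a problem already discussed in part I on the whole torus. The solution is the same here. The
variational equation for Φ_k is (a_k + (a/L²)QᵀQ)Φ_k = a_kQ_kφ + (a/L²)QᵀΦ_{k+1}  (cherry0).  The solution is Ψ_k =
Ψ_{k,Ω_{k+1}} = Ψ_{k,Ω_{k+1}}(Φ_{k+1}, φ) given by Ψ_k = Q_kφ − (aL^{−2}/(a_k + aL^{−2}))QᵀQ_{k+1}φ + (aL^{−2}/(a_k +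
aL^{−2}))QᵀΦ_{k+1}  (psik).  A short calculation shows that the value of (stringy) at the minimum is (a/2L²)‖Φ_{k+1} −
QΨ_k‖²_{Ω_{k+1}} + (a_k/2)‖Ψ_k − Q_kφ‖²_{Ω_{k+1}} = (a_{k+1}/2L²)‖Φ_{k+1} − Q_{k+1}φ‖²_{Ω_{k+1}}  (stringy2)"*; L531–534:
*"write Φ_{k,Ω_{k+1}} = Ψ_{k,Ω_{k+1}} + Z … The terms with no Z's are (stringy2), the terms linear in Z vanish, and the
terms quadratic in Z when integrated over Z yield a constant."*  L466: *"define Q_jΦ = Q^jΦ"* (so `Q_{k+1} = QQ_k`).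
[Dimock2013] L440: *"Let Q_k = Q^k be averaging operator over cubes"*; (ak) L516–518: *"Here we use the identity a_{k+1} =
a_ka/(a_k + aL^{−2})"*; (potpie) L503–506: *"Φ_{k+1} − QΨ_k =
(a_k/(a_k + aL^{−2}))(Φ_{k+1} − Q_{k+1}φ)"*; (fifty) L531–535.  [Dimock2013BalabanII] §2.3 L716–729: *"we would want to
compute (ignoring constants) ∫ exp(−J_{Ω⁺}(Φ_{k+1}, Φ_{k,Ω}, (φ_{Ω₁ᶜ}, φ_{k,Ω}))) dΦ_{k,Ω_{k+1}}  where … J_{Ω⁺}(Φ_{k+1},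
Φ_{k,Ω}, φ) = ½(a/L²)‖Φ_{k+1} − QΦ_k‖²_{Ω_{k+1}} + ½‖𝐚^{1/2}(Φ_{k,Ω} − Q_{k,Ω}φ)‖²_{Ω₁} + ½⟨φ, (−Δ + μ̄_k)φ⟩"*; L731–736:
*"To evaluate this integral we need to find the minimizer of J_{Ω⁺}(Φ_{k+1}, Φ_{k,Ω}, (φ_{Ω₁ᶜ}, φ_{k,Ω})) in Φ_{k,Ω_{k+1}}.
Since this function is the minimum of J_{Ω⁺}(Φ_{k+1}, Φ_{k,Ω}, φ) in φ_{Ω₁}, we can proceed by finding the minimum of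
J_{Ω⁺}(Φ_{k+1}, Φ_{k,Ω}, φ) simultaneously in φ_{Ω₁}, Φ_{k,Ω_{k+1}}."*  **Lemma 2.3** (L739–793): *"1. The unique minimum
of J_{Ω⁺}(Φ_{k+1}, Φ_{k,Ω}, φ) in φ_{Ω₁}, Φ_{k,Ω_{k+1}} comes at φ_{Ω₁} = φ⁰_{k+1,Ω⁺} where φ⁰_{k+1,Ω⁺}(φ_{Ω₁ᶜ}, Φ_{k+1,Ω⁺})
= G⁰_{k+1,Ω⁺}(L^{−2}Qᵀ_{k+1,Ω⁺}𝐚^{(k+1)}Φ_{k+1,Ω⁺} + [Δ]_{Ω₁,Ω₁ᶜ}φ_{Ω₁ᶜ})  (eddie)  with  G⁰_{k+1,Ω⁺} = [−Δ + μ̄_k +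
L^{−2}Qᵀ_{k+1,Ω⁺}𝐚^{(k+1)}Q_{k+1,Ω⁺}]^{−1}_{Ω₁}  (eddie1)  and at Φ_{k,Ω_{k+1}} = Ψ_{k,Ω_{k+1}}(Ω⁺) where Ψ_{k,Ω_{k+1}}(Ω⁺) ≡
Ψ_{k,Ω_{k+1}}(Φ_{k+1}, φ⁰_{k+1,Ω⁺}) = Q_kφ⁰_{k+1,Ω⁺} − (aL^{−2}/(a_k + aL^{−2}))QᵀQ_{k+1}φ⁰_{k+1,Ω⁺} + (aL^{−2}/(a_k +
aL^{−2}))QᵀΦ_{k+1}  (eddie2).  2. Let Ψ_{k,Ω⁺} be Φ_{k,Ω} with Φ_{k,Ω_{k+1}} replaced by the minimizer Ψ_{k,Ω_{k+1}}(Ω⁺) …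
Then the minimizer in φ can also be written φ_{k,Ω}(φ_{Ω₁ᶜ}, Ψ_{k,Ω⁺}) so we have the identity φ⁰_{k+1,Ω⁺} =
φ_{k,Ω}(φ_{Ω₁ᶜ}, Ψ_{k,Ω⁺})  (loopy).  3. The value of J_{Ω⁺}(Φ_{k+1}, Φ_{k,Ω}, φ) at the minimizer is: ½⟨φ_{Ω₁ᶜ}, [−Δ +
μ̄_k]_{Ω₁ᶜ}φ_{Ω₁ᶜ}⟩ + ⟨φ_{Ω₁ᶜ}, [−Δ]_{Ω₁,Ω₁ᶜ}φ⁰_{k+1,Ω⁺}⟩ + S⁰_{k+1}(Ω₁, Φ_{k+1,Ω⁺}, φ⁰_{k+1,Ω⁺})  (nono)  where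
S⁰_{k+1}(Ω₁, Φ_{k+1,Ω⁺}, φ) = ½Σ_{j=1}^k a^{(k)}_j‖Φ_j − Q_jφ‖²_{δΩ_j} + (a_{k+1}/2L²)‖Φ_{k+1} − Q_{k+1}φ‖²_{Ω_{k+1}} + ½⟨φ,
[−Δ + μ̄_k]_{Ω₁}φ⟩"*; proof L796–867: *"the variational equations for J in φ = φ_{Ω₁} and Φ_k = Φ_{k,Ω_{k+1}} are (a_k +
(a/L²)QᵀQ)Φ_k = a_kQ_kφ + QᵀΦ_{k+1}* ⟦sic: the coefficient `a/L²` of `QᵀΦ_{k+1}`, present in (cherry0) and in I L481, is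
dropped in print⟧ *, (−Δ + μ̄_k + Q_{k,Ω}ᵀ𝐚^{(k)}Q_{k,Ω})φ = Q_{k,Ω}ᵀ𝐚^{(k)}Φ_{k,Ω} + [Δ]_{Ω₁,Ω₁ᶜ}φ_{Ω₁ᶜ}  (cherry)  Both of
these we have seen before. … Then the second equation becomes (−Δ + μ̄_k + Σ_{j=1}^k[Q_jᵀa^{(k)}_jQ_j]_{δΩ_j} +
L^{−2}[Qᵀ_{k+1}a_{k+1}Q_{k+1}]_{Ω_{k+1}})φ = Σ_{j=1}^k a^{(k)}_jQ_jᵀΦ_{j,δΩ_j} + L^{−2}a_{k+1}Qᵀ_{k+1}Φ_{k+1} +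
[Δ]_{Ω₁,Ω₁ᶜ}φ_{Ω₁ᶜ}.  This has the solution φ = φ⁰_{k+1,Ω⁺} … Replace Φ_{k,Ω} by Ψ_{k,Ω⁺} in the second equation in (cherry)
and solve for φ. We find that φ = φ_{k,Ω}(φ_{Ω₁ᶜ}, Ψ_{k,Ω⁺}) … However just as in (stringy2) the first two terms combine
to give ½a_{k+1}L^{−2}‖Φ_{k+1} − Q_{k+1}φ‖²_{Ω_{k+1}}"*.  The expansion (L871–909): *"Put Φ_{k,Ω_{k+1}} = Ψ_{k,Ω_{k+1}}(Ω⁺)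
+ Z … φ_{k,Ω}(φ_{Ω₁ᶜ}, Ψ_{k,Ω⁺} + (0,Z)) = φ_{k,Ω}(φ_{Ω₁ᶜ}, Ψ_{k,Ω⁺}) + a_kG_{k,Ω}Q_kᵀZ = φ⁰_{k+1,Ω⁺} + 𝒵_{k,Ω}.  Here
we have used (loopy) and defined 𝒵_{k,Ω} = φ_{k,Ω}(0,Z) = a_kG_{k,Ω}Q_kᵀZ.  Now we claim that J_{Ω⁺}(Φ_{k+1}, Ψ_{k,Ω⁺} +
(0,Z), (φ_{Ω₁ᶜ}, φ⁰_{k+1,Ω⁺} + 𝒵_{k,Ω})) = [the three terms of (nono)] + ½(Z, [Δ_{k,Ω} + (a/L²)QᵀQ]_{Ω_{k+1}}Z)  (expand)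
That the first three terms are the value at Z = 0 follows from the previous lemma. The linear terms must vanish. Thus
we only have to look at the quadratic terms in Z which are (a/2L²)‖QZ‖²_{Ω_{k+1}} + S_k(Ω₁, (0,Z), 𝒵_{k,Ω}) =
(a/2L²)‖QZ‖²_{Ω_{k+1}} + ½(Z, [Δ_{k,Ω}]_{Ω_{k+1}}Z)  (worry)  The second form follows from (ping)."*; (cloudy3) L911–918:
*"The original integral (thefirst) with Z as the integration variable would now be evaluated as exp(…)∫exp(−½(Z,
[Δ_{k,Ω} + (a/L²)QᵀQ]_{Ω_{k+1}}Z))dZ"*.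

**What is reproduced here (kernel-checked, zero `sorry`), in the finite index model of `MultiRegionFreeFlow`.**
CARRIER as there: `κ` (sites of `Ω₁`, `D = [−Δ + μ̄_k]_{Ω₁}` any positive-definite matrix), the multiscale variable
split `ι ⊕ τ` (`ι = Ω^{(k)}_{k+1}` carrying `Φ_{k,Ω_{k+1}}` with weight `a_k`, `τ` the layers with weight `𝐚_τ ≥ 0`),
`Q_k : Matrix ι κ ℝ`, `Q_τ : Matrix τ κ ℝ`, the next lattice `σ = Ω^{(k+1)}_{k+1}` with the one-step averaging
`Q : Matrix σ ι ℝ`, `QQᵀ = I`, `Q_{k+1} := QQ_k`; `aL` stands for `a/L²` and `a′ := a_k·aL/(a_k + aL)` for `a_{k+1}L^{−2}`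
(by (ak)).  PROVED:
* §2 THE ONE-STEP MINIMIZATION: `Psi` (psik) solves (cherry0) (`oneStepH_mulVec_Psi`), (potpie) (`sub_Q_mulVec_Psi`),
  (tea)'s `Ψ_k − Q_kφ = (aL/(a_k+aL))Qᵀ(Φ_{k+1} − Q_{k+1}φ)` (`Psi_sub`), the value **(stringy2) = (fifty)** (`stringy_Psi`)
  and the completed square `stringy Φ_k = stringy Ψ_k + ½⟨Φ_k − Ψ_k, (a_k + aL·QᵀQ)(Φ_k − Ψ_k)⟩` (`stringy_Psi_add` /
  `stringy_eq` —
  *"the terms linear in Z vanish"*), with `a_k + aL·QᵀQ > 0` (`oneStepH_posDef`);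
* §3 **LEMMA 2.3**: the decomposition `J = E′(φ) + ½⟨Φ_{k,Ω_{k+1}} − Ψ_k(φ), (a_k + aL·QᵀQ)(…)⟩` (`J_eq`) where `E′` is
  `MultiRegionFreeFlow.energy` for the NEXT-level data (weight `a′ ⊕ 𝐚_τ`, rows `(QQ_k, Q_τ)` — its bracket is (eddie1)
  `G⁰_{k+1,Ω⁺}⁻¹`, `gInvO_next`), hence part 1 (`J_joint_min`, `J_eq_joint_min_iff`: the unique joint minimum at
  `(φ⁰_{k+1,Ω⁺}, Ψ_k(Φ_{k+1}, φ⁰))` with `φ⁰ = minimizer …` = (eddie), its equation `phi0_eq` = L823–829), part 2 (loopy)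
  (`minimizer_Psi_phi0`), part 3 (nono) (`J_at_min`);
* §4 **THE EXPANSION**: `𝒵_{k,Ω} = a_kG_{k,Ω}Q_kᵀZ` (`calZ_eq`), `φ_{k,Ω}(·, Ψ + (0,Z)) = φ_{k,Ω}(·, Ψ) + 𝒵_{k,Ω}`
  (`minimizer_inl_add`), and **(expand)** `J(Φ_{k+1}, Ψ + Z, φ⁰ + 𝒵_{k,Ω}) = J_min + ½⟨Z, ([Δ_{k,Ω}]_{Ω_{k+1}} + aL·QᵀQ)Z⟩`
  (`J_expand`; (worry) = `quadratic_terms`), the bracket being the inverse of `MultiRegionFreeFlow.CkOr … aL 0` = App. C's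
  `C_{k,Ω⁺,r}` at `r = 0` (`bracket_mul_CkOr`) — so the `Z`-integral (cloudy3) is the Gaussian with covariance (z4).

**Deviations (declared).**  Those of `MultiRegionFreeFlow` (finite index types; boundary datum as a source `src =
[Δ]_{Ω₁,Ω₁ᶜ}φ_{Ω₁ᶜ}`, so `J` here is the printed `J_{Ω⁺}` at `φ = (φ_{Ω₁ᶜ}, φ_{Ω₁})` MINUS the `φ_{Ω₁ᶜ}`-only constant
`½⟨φ_{Ω₁ᶜ}, [−Δ + μ̄_k]_{Ω₁ᶜ}φ_{Ω₁ᶜ}⟩`, and (nono)'s first two terms appear as `−⟨φ, src⟩` inside `E′`); `aL = a/L² ≥ 0`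
(print `> 0`); the new weight written `a′ = a_k·aL/(a_k + aL)` rather than `a_{k+1}L^{−2}`.

**What is NOT claimed.**  The Gaussian integrals/constants, the scaling identities (lumpy)/(oooo) L920–948, §2.4 (Lemmas
2.4–2.5 with the boundary term `𝔟_Λ` — see `StarFormIdentity`), anything of B1–B16 (TEMPLATE.md §4.2 row «D2 §2.3 Lemmas
2.3, 2.5» maps the step to B6 §A / B9 Thms 3.1–3.3 / B10 (52), grades T/P).  NOT summit progress; NOT a statement about
any Bałaban paper; NOT continuum; NOT Clay.  Unit `b2b-balaban-template` gen 29 (journal CLAIM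
D2-FREEFLOW-SINGLESTEP-KERNEL).

**Version.**  v1.0.1 — DOCFIX fold of the outside-lineage XREAD VERDICT (cell journal l.2263, GAPS C-beta-an3-49:
ok CONSISTENT 4/4, DOCFIX 5 = 2 real + 3 optional, INFO 3): (F1) the sentence *"define Q_jΦ = Q^jΦ"* is L466 of THIS
paper ([Dimock2013BalabanII]); part I's own wording is L440 — keys corrected above; (F2) the completed square is the pair
`stringy_Psi_add` / `stringy_eq` (v1's header named a non-existent `stringy_eq_Psi_add`); (F3–F5) TeX locators corrected —
(eddie2) = L758–764, (eddie)–(eddie1) = L743–756 with (eddie1) the display L754–756, the sentence *"However just as in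
(stringy2) …"* = L856–857, and *"‖QᵀΦ‖² = ‖Φ‖²"* = [Dimock2013] L521.  Docstring-only: every declaration, statement and
proof is byte-identical to v1 (p198550).
-/

namespace Literature.MathematicalPhysics.QuantumFieldTheory.Dimock2011to13.FreeFlowSingleStep

open Matrix
open scoped Matrix
open Literature.MathematicalPhysics.QuantumFieldTheory.Dimock2011to13.FluctuationCovarianceIdentity
open Literature.MathematicalPhysics.QuantumFieldTheory.Dimock2011to13.MultiRegionFreeFlow

variable {κ ι σ : Type*} [Fintype κ] [Fintype ι] [Fintype σ] [DecidableEq κ] [DecidableEq ι] [DecidableEq σ]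

/-! ## §1 The one-step objects of [Dimock2013BalabanII] §2.1 / [Dimock2013] §2.2 -/

/-- `a′ := a_k·aL/(a_k + aL)` — the next weight `a_{k+1}L^{−2}` by *"the identity a_{k+1} = a_ka/(a_k + aL^{−2})"* with
`aL = a/L²`. [cite: Dimock2013, §2.2 (ak) L516–518 (arXiv:1108.1335v2 TeX); Dimock2013BalabanII, §2.1 (stringy2) L525–529] -/
noncomputable def aNext (ak aL : ℝ) : ℝ := ak * aL / (ak + aL)

/-- `Ψ_k(Φ_{k+1}, φ) = Q_kφ − (aL^{−2}/(a_k + aL^{−2}))QᵀQ_{k+1}φ + (aL^{−2}/(a_k + aL^{−2}))QᵀΦ_{k+1}` with `Q_{k+1} = QQ_k`.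
[cite: Dimock2013BalabanII, §2.1 (psik) L520–524 and Lemma 2.3 (eddie2) L758–764 (arXiv:1212.5562v2 TeX); Dimock2013,
(kingmaker0) L484–490] -/
noncomputable def Psi (Qk : Matrix ι κ ℝ) (Q : Matrix σ ι ℝ) (ak aL : ℝ) (Φ' : σ → ℝ) (φ : κ → ℝ) : ι → ℝ :=
  Qk *ᵥ φ - (aL / (ak + aL)) • (Qᵀ *ᵥ (Q *ᵥ (Qk *ᵥ φ))) + (aL / (ak + aL)) • (Qᵀ *ᵥ Φ')

/-- the one-step functional (stringy): `(a/2L²)‖Φ_{k+1} − QΦ_k‖² + (a_k/2)‖Φ_k − Q_kφ‖²` as a function of `Φ_k`.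
[cite: Dimock2013BalabanII, §2.1 (stringy) L510–513 (arXiv:1212.5562v2 TeX)] -/
noncomputable def stringy (Qk : Matrix ι κ ℝ) (Q : Matrix σ ι ℝ) (ak aL : ℝ) (Φ' : σ → ℝ) (φ : κ → ℝ)
    (Φι : ι → ℝ) : ℝ :=
  (aL / 2) * ((Φ' - Q *ᵥ Φι) ⬝ᵥ (Φ' - Q *ᵥ Φι)) + (ak / 2) * ((Φι - Qk *ᵥ φ) ⬝ᵥ (Φι - Qk *ᵥ φ))

/-- the bracket `a_k + (a/L²)QᵀQ` of the variational equation (cherry0). [cite: Dimock2013BalabanII, §2.1 (cherry0)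
L516–518 (arXiv:1212.5562v2 TeX)] -/
noncomputable def oneStepH (Q : Matrix σ ι ℝ) (ak aL : ℝ) : Matrix ι ι ℝ := ak • (1 : Matrix ι ι ℝ) + aL • proj Q

/-! ### [folklore] helpers -/

section Helpers

omit [DecidableEq ι] in
/-- `QQᵀ = I ⇒ Q(Qᵀv) = v`. [folklore] -/
private theorem Q_mulVec_transpose_mulVec {Q : Matrix σ ι ℝ} (hQ : Q * Qᵀ = 1) (v : σ → ℝ) :
    Q *ᵥ (Qᵀ *ᵥ v) = v := by
  rw [mulVec_mulVec, hQ, one_mulVec]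

omit [DecidableEq ι] in
/-- `QQᵀ = I ⇒ ‖Qᵀw‖² = ‖w‖²` (*"‖QᵀΦ‖² = ‖Φ‖²"*, I L521). [folklore] -/
private theorem transpose_mulVec_dot_self {Q : Matrix σ ι ℝ} (hQ : Q * Qᵀ = 1) (w : σ → ℝ) :
    (Qᵀ *ᵥ w) ⬝ᵥ (Qᵀ *ᵥ w) = w ⬝ᵥ w := by
  rw [dotProduct_mulVec, vecMul_transpose, Q_mulVec_transpose_mulVec hQ]

omit [DecidableEq ι] [DecidableEq σ] in
/-- `⟨Z, QᵀQ Z'⟩ = ⟨QZ, QZ'⟩`. [folklore] -/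
private theorem dot_proj_mulVec (Q : Matrix σ ι ℝ) (Z Z' : ι → ℝ) :
    Z ⬝ᵥ (proj Q *ᵥ Z') = (Q *ᵥ Z) ⬝ᵥ (Q *ᵥ Z') := by
  unfold proj
  rw [← mulVec_mulVec, dotProduct_mulVec, vecMul_transpose]

omit [DecidableEq ι] [DecidableEq σ] in
/-- `⟨QZ, w⟩ = ⟨Z, Qᵀw⟩`. [folklore] -/
private theorem Q_mulVec_dot (Q : Matrix σ ι ℝ) (Z : ι → ℝ) (w : σ → ℝ) :
    (Q *ᵥ Z) ⬝ᵥ w = Z ⬝ᵥ (Qᵀ *ᵥ w) := by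
  rw [dotProduct_mulVec, vecMul_transpose]

end Helpers

/-! ## §2 The one-step minimization: (cherry0), (psik), (potpie), (stringy2) = (fifty) -/

section OneStep

variable {Qk : Matrix ι κ ℝ} {Q : Matrix σ ι ℝ} {ak aL : ℝ}

omit [DecidableEq κ] [DecidableEq ι] [DecidableEq σ] in
/-- (tea): `Ψ_k − Q_kφ = (aL/(a_k + aL))Qᵀ(Φ_{k+1} − Q_{k+1}φ)`. [cite: Dimock2013, §2.2 (kingmaker0)/(tea) L484–490,
L520–527 (arXiv:1108.1335v2 TeX); Dimock2013BalabanII, (psik) L520–524] -/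
theorem Psi_sub (Φ' : σ → ℝ) (φ : κ → ℝ) :
    Psi Qk Q ak aL Φ' φ - Qk *ᵥ φ = (aL / (ak + aL)) • (Qᵀ *ᵥ (Φ' - Q *ᵥ (Qk *ᵥ φ))) := by
  unfold Psi
  rw [mulVec_sub, smul_sub]
  abel

omit [DecidableEq κ] [DecidableEq ι] in
/-- (potpie): *"Φ_{k+1} − QΨ_k = (a_k/(a_k + aL^{−2}))(Φ_{k+1} − Q_{k+1}φ)"* (uses `QQᵀ = I`). [cite: Dimock2013, §2.2
(potpie) L492–506 (arXiv:1108.1335v2 TeX)] -/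
theorem sub_Q_mulVec_Psi (hQ : Q * Qᵀ = 1) (h : ak + aL ≠ 0) (Φ' : σ → ℝ) (φ : κ → ℝ) :
    Φ' - Q *ᵥ Psi Qk Q ak aL Φ' φ = (ak / (ak + aL)) • (Φ' - Q *ᵥ (Qk *ᵥ φ)) := by
  have hc : ak / (ak + aL) = 1 - aL / (ak + aL) := by
    field_simp
    ring
  unfold Psi
  rw [mulVec_add, mulVec_sub, mulVec_smul, mulVec_smul, Q_mulVec_transpose_mulVec hQ,
    Q_mulVec_transpose_mulVec hQ, hc, sub_smul, one_smul, smul_sub]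
  abel

omit [DecidableEq κ] in
/-- **(cherry0)**: `Ψ_k` solves `(a_k + (a/L²)QᵀQ)Φ_k = a_kQ_kφ + (a/L²)QᵀΦ_{k+1}` (uses `QQᵀ = I`).
[cite: Dimock2013BalabanII, §2.1 (cherry0)–(psik) L514–524 (arXiv:1212.5562v2 TeX); Dimock2013, L479–490] -/
theorem oneStepH_mulVec_Psi (hQ : Q * Qᵀ = 1) (h : ak + aL ≠ 0) (Φ' : σ → ℝ)
    (φ : κ → ℝ) :
    oneStepH Q ak aL *ᵥ Psi Qk Q ak aL Φ' φ = ak • (Qk *ᵥ φ) + aL • (Qᵀ *ᵥ Φ') := by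
  -- write Ψ = Q_kφ + c Qᵀw (w = Φ_{k+1} − Q_{k+1}φ) and use P Qᵀ = Qᵀ, P Q_kφ = QᵀQ_{k+1}φ
  set w : σ → ℝ := Φ' - Q *ᵥ (Qk *ᵥ φ) with hw
  have hΨ : Psi Qk Q ak aL Φ' φ = Qk *ᵥ φ + (aL / (ak + aL)) • (Qᵀ *ᵥ w) := by
    rw [← Psi_sub Φ' φ]
    abel
  have hP : proj Q *ᵥ (Qᵀ *ᵥ w) = Qᵀ *ᵥ w := by
    unfold proj
    rw [← mulVec_mulVec, Q_mulVec_transpose_mulVec hQ]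
  have hPQk : proj Q *ᵥ (Qk *ᵥ φ) = Qᵀ *ᵥ (Q *ᵥ (Qk *ᵥ φ)) := by
    unfold proj
    rw [← mulVec_mulVec]
  have hΦ' : Qᵀ *ᵥ Φ' = Qᵀ *ᵥ w + Qᵀ *ᵥ (Q *ᵥ (Qk *ᵥ φ)) := by
    rw [← mulVec_add, hw, sub_add_cancel]
  have h1 : ak * (aL / (ak + aL)) + aL * (aL / (ak + aL)) = aL := by
    field_simp
  have h1' : aL • (Qᵀ *ᵥ w) = (ak * (aL / (ak + aL))) • (Qᵀ *ᵥ w) + (aL * (aL / (ak + aL))) • (Qᵀ *ᵥ w) := by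
    rw [← add_smul, h1]
  unfold oneStepH
  rw [hΨ, add_mulVec, smul_mulVec, one_mulVec, smul_mulVec, mulVec_add, mulVec_smul, hP, hPQk, hΦ', smul_add,
    smul_add, smul_add, smul_smul, smul_smul, h1']
  abel

omit [DecidableEq κ] [DecidableEq ι] in
/-- **(stringy2) = (fifty)**: the value of (stringy) at `Ψ_k` is `(a′/2)‖Φ_{k+1} − Q_{k+1}φ‖²`, `a′ = a_{k+1}L^{−2}`
(*"A short calculation shows"* — I (potpie)/(tee)/(tea)/(fifty), using `‖QᵀΦ‖² = ‖Φ‖²`).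
[cite: Dimock2013BalabanII, §2.1 (stringy2) L525–529 (arXiv:1212.5562v2 TeX); Dimock2013, (fifty) L531–535] -/
theorem stringy_Psi (hQ : Q * Qᵀ = 1) (h : ak + aL ≠ 0) (Φ' : σ → ℝ) (φ : κ → ℝ) :
    stringy Qk Q ak aL Φ' φ (Psi Qk Q ak aL Φ' φ)
      = (aNext ak aL / 2) * ((Φ' - Q *ᵥ (Qk *ᵥ φ)) ⬝ᵥ (Φ' - Q *ᵥ (Qk *ᵥ φ))) := by
  unfold stringy aNext
  rw [sub_Q_mulVec_Psi hQ h, Psi_sub, smul_dotProduct, dotProduct_smul, smul_dotProduct, dotProduct_smul,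
    transpose_mulVec_dot_self hQ]
  simp only [smul_eq_mul]
  field_simp

omit [DecidableEq κ] in
/-- the completed square about `Ψ_k`: for every `Z`, `stringy(Ψ_k + Z) = stringy(Ψ_k) + ½⟨Z, (a_k + aL·QᵀQ)Z⟩` —
*"the terms linear in Z vanish, and the terms quadratic in Z …"*. [cite: Dimock2013BalabanII, §2.1 L531–534
(arXiv:1212.5562v2 TeX)] -/
theorem stringy_Psi_add (hQ : Q * Qᵀ = 1) (h : ak + aL ≠ 0) (Φ' : σ → ℝ) (φ : κ → ℝ)
    (Z : ι → ℝ) :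
    stringy Qk Q ak aL Φ' φ (Psi Qk Q ak aL Φ' φ + Z)
      = stringy Qk Q ak aL Φ' φ (Psi Qk Q ak aL Φ' φ) + (1 / 2) * (Z ⬝ᵥ (oneStepH Q ak aL *ᵥ Z)) := by
  set w : σ → ℝ := Φ' - Q *ᵥ (Qk *ᵥ φ) with hw
  have hu : Φ' - Q *ᵥ Psi Qk Q ak aL Φ' φ = (ak / (ak + aL)) • w := sub_Q_mulVec_Psi hQ h Φ' φ
  have hv : Psi Qk Q ak aL Φ' φ - Qk *ᵥ φ = (aL / (ak + aL)) • (Qᵀ *ᵥ w) := Psi_sub Φ' φ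
  have h1 : Φ' - Q *ᵥ (Psi Qk Q ak aL Φ' φ + Z) = (ak / (ak + aL)) • w - Q *ᵥ Z := by
    rw [mulVec_add, ← sub_sub, hu]
  have h2 : Psi Qk Q ak aL Φ' φ + Z - Qk *ᵥ φ = (aL / (ak + aL)) • (Qᵀ *ᵥ w) + Z := by
    rw [← hv]
    abel
  have hH : Z ⬝ᵥ (oneStepH Q ak aL *ᵥ Z) = ak * (Z ⬝ᵥ Z) + aL * ((Q *ᵥ Z) ⬝ᵥ (Q *ᵥ Z)) := by
    unfold oneStepH
    rw [add_mulVec, dotProduct_add, smul_mulVec, one_mulVec, dotProduct_smul, smul_mulVec, dotProduct_smul,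
      dot_proj_mulVec, smul_eq_mul, smul_eq_mul]
  have hQZw : (Q *ᵥ Z) ⬝ᵥ w = Z ⬝ᵥ (Qᵀ *ᵥ w) := Q_mulVec_dot Q Z w
  unfold stringy
  rw [h1, h2, hu, hv, hH]
  simp only [sub_dotProduct, dotProduct_sub, add_dotProduct, dotProduct_add, smul_dotProduct, dotProduct_smul,
    smul_eq_mul]
  rw [dotProduct_comm w (Q *ᵥ Z), hQZw, dotProduct_comm (Qᵀ *ᵥ w) Z]
  field_simp
  ring

omit [DecidableEq κ] in
/-- … hence for every `Φ_k`: `stringy(Φ_k) = (a′/2)‖Φ_{k+1} − Q_{k+1}φ‖² + ½⟨Φ_k − Ψ_k, (a_k + aL·QᵀQ)(Φ_k − Ψ_k)⟩`.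
[cite: Dimock2013BalabanII, §2.1 (stringy2) and L531–534 (arXiv:1212.5562v2 TeX)] -/
theorem stringy_eq (hQ : Q * Qᵀ = 1) (h : ak + aL ≠ 0) (Φ' : σ → ℝ) (φ : κ → ℝ)
    (Φι : ι → ℝ) :
    stringy Qk Q ak aL Φ' φ Φι
      = (aNext ak aL / 2) * ((Φ' - Q *ᵥ (Qk *ᵥ φ)) ⬝ᵥ (Φ' - Q *ᵥ (Qk *ᵥ φ)))
        + (1 / 2) * ((Φι - Psi Qk Q ak aL Φ' φ) ⬝ᵥ (oneStepH Q ak aL *ᵥ (Φι - Psi Qk Q ak aL Φ' φ))) := by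
  have hs := stringy_Psi_add (Qk := Qk) hQ h Φ' φ (Φι - Psi Qk Q ak aL Φ' φ)
  rw [add_sub_cancel, stringy_Psi hQ h] at hs
  exact hs

omit [DecidableEq σ] in
/-- `a_k + (a/L²)QᵀQ` is positive definite for `a_k > 0`, `aL ≥ 0` (so `Ψ_k` is THE minimizer and the `Z`-integral of
L531–534 is Gaussian). [cite: Dimock2013BalabanII, §2.1 (cherry0) L516–518 and L531–534 (arXiv:1212.5562v2 TeX)] -/
theorem oneStepH_posDef (hak : 0 < ak) (haL : 0 ≤ aL) : (oneStepH Q ak aL).PosDef := by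
  unfold oneStepH proj
  refine PosDef.add_posSemidef ?_ ?_
  · exact PosDef.one.smul hak
  · have h := Matrix.posSemidef_conjTranspose_mul_self Q
    rw [conjTranspose_eq_transpose_of_trivial] at h
    exact h.smul haL

end OneStep

/-! ## §3 Lemma 2.3 (otto1): the joint minimizer of `J_{Ω⁺}` in `(φ_{Ω₁}, Φ_{k,Ω_{k+1}})` -/

section Otto

variable {τ : Type*} [Fintype τ]
variable {D : Matrix κ κ ℝ} {ak : ℝ} {aτ : Matrix τ τ ℝ} {Qk : Matrix ι κ ℝ} {Qτ : Matrix τ κ ℝ} {Q : Matrix σ ι ℝ}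
  {aL : ℝ}

/-- `J_{Ω⁺}(Φ_{k+1}, Φ_{k,Ω}, φ) = (a/2L²)‖Φ_{k+1} − QΦ_{k,Ω_{k+1}}‖² + ½‖𝐚^{1/2}(Φ_{k,Ω} − Q_{k,Ω}φ)‖² + ½⟨φ, (−Δ + μ̄_k)φ⟩`
as a function of `(Φ_{k,Ω_{k+1}}, φ_{Ω₁})`, the `φ_{Ω₁ᶜ}`-coupling carried by the source `src` (the `φ_{Ω₁ᶜ}`-only constant
dropped): `(aL/2)‖Φ_{k+1} − QΦ_{k,Ω_{k+1}}‖² + MultiRegionFreeFlow.energy`. [cite: Dimock2013BalabanII, §2.3 (thefirst)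
L716–729 (arXiv:1212.5562v2 TeX)] -/
noncomputable def J (D : Matrix κ κ ℝ) (ak : ℝ) (aτ : Matrix τ τ ℝ) (Qk : Matrix ι κ ℝ) (Qτ : Matrix τ κ ℝ)
    (Q : Matrix σ ι ℝ) (aL : ℝ) (Φ' : σ → ℝ) (Φτ : τ → ℝ) (src : κ → ℝ) (Φι : ι → ℝ) (φ : κ → ℝ) : ℝ :=
  (aL / 2) * ((Φ' - Q *ᵥ Φι) ⬝ᵥ (Φ' - Q *ᵥ Φι)) + energy D (weightO ak aτ) (rowsO Qk Qτ) (Sum.elim Φι Φτ) src φ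

/-- the NEXT-LEVEL exponent `E′(φ) = S⁰_{k+1}(Ω₁, Φ_{k+1,Ω⁺}, φ) − ⟨φ, src⟩`: `MultiRegionFreeFlow.energy` with the weight
`a′ ⊕ 𝐚_τ` (= `L^{−2}𝐚^{(k+1)}`) and the rows `(Q_{k+1}, Q_τ) = (QQ_k, Q_τ)` (= `Q_{k+1,Ω⁺}`).
[cite: Dimock2013BalabanII, Lemma 2.3 (nono) L777–791 (arXiv:1212.5562v2 TeX)] -/
noncomputable def energyNext (D : Matrix κ κ ℝ) (ak : ℝ) (aτ : Matrix τ τ ℝ) (Qk : Matrix ι κ ℝ) (Qτ : Matrix τ κ ℝ)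
    (Q : Matrix σ ι ℝ) (aL : ℝ) (Φ' : σ → ℝ) (Φτ : τ → ℝ) (src φ : κ → ℝ) : ℝ :=
  energy D (weightO (aNext ak aL) aτ) (rowsO (Q * Qk) Qτ) (Sum.elim Φ' Φτ) src φ

/-- `φ⁰_{k+1,Ω⁺}(φ_{Ω₁ᶜ}, Φ_{k+1,Ω⁺}) = G⁰_{k+1,Ω⁺}(L^{−2}Qᵀ_{k+1,Ω⁺}𝐚^{(k+1)}Φ_{k+1,Ω⁺} + [Δ]_{Ω₁,Ω₁ᶜ}φ_{Ω₁ᶜ})` (eddie) with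
`G⁰_{k+1,Ω⁺} = [−Δ + μ̄_k + L^{−2}Qᵀ_{k+1,Ω⁺}𝐚^{(k+1)}Q_{k+1,Ω⁺}]^{−1}_{Ω₁}` (eddie1) = `MultiRegionFreeFlow.minimizer` for the
next-level data. [cite: Dimock2013BalabanII, Lemma 2.3 (eddie)–(eddie1) L743–756 (arXiv:1212.5562v2 TeX)] -/
noncomputable def phi0 (D : Matrix κ κ ℝ) (ak : ℝ) (aτ : Matrix τ τ ℝ) (Qk : Matrix ι κ ℝ) (Qτ : Matrix τ κ ℝ)
    (Q : Matrix σ ι ℝ) (aL : ℝ) (Φ' : σ → ℝ) (Φτ : τ → ℝ) (src : κ → ℝ) : κ → ℝ :=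
  minimizer D (weightO (aNext ak aL) aτ) (rowsO (Q * Qk) Qτ) (Sum.elim Φ' Φτ) src

/-- the split weight is positive semidefinite for `a ≥ 0`, `𝐚_τ ≥ 0`. [folklore] -/
private theorem weightO_posSemidef {a : ℝ} (ha : 0 ≤ a) (haτ : aτ.PosSemidef) :
    (weightO (ι := ι) a aτ).PosSemidef := by
  have hH : (weightO (ι := ι) a aτ).IsHermitian := by
    unfold weightO
    refine Matrix.IsHermitian.fromBlocks ?_ (by simp) haτ.isHermitian
    rw [IsHermitian, conjTranspose_smul, star_trivial, conjTranspose_one]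
  refine PosSemidef.of_dotProduct_mulVec_nonneg hH fun x => ?_
  rw [star_trivial]
  unfold weightO
  conv_rhs => rw [← Sum.elim_comp_inl_inr x, fromBlocks_mulVec]
  simp only [Sum.elim_comp_inl, Sum.elim_comp_inr, zero_mulVec, add_zero, zero_add, sumElim_dotProduct_sumElim,
    smul_mulVec, one_mulVec, dotProduct_smul, smul_eq_mul]
  have h1 : 0 ≤ (x ∘ Sum.inl) ⬝ᵥ (x ∘ Sum.inl) := Finset.sum_nonneg fun i _ => mul_self_nonneg _
  have h2 : 0 ≤ (x ∘ Sum.inr) ⬝ᵥ (aτ *ᵥ (x ∘ Sum.inr)) := by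
    have := haτ.dotProduct_mulVec_nonneg (x ∘ Sum.inr)
    rwa [star_trivial] at this
  exact add_nonneg (mul_nonneg ha h1) h2

/-- `a′ ≥ 0` for `a_k > 0`, `aL ≥ 0`. [folklore] -/
private theorem aNext_nonneg {b c : ℝ} (hb : 0 < b) (hc : 0 ≤ c) : 0 ≤ aNext b c := by
  unfold aNext
  positivity

omit [Fintype κ] [DecidableEq κ] [DecidableEq ι] in
/-- the bracket of `G⁰_{k+1,Ω⁺}` (eddie1) in the model: `D + E + a′(QQ_k)ᵀ(QQ_k)` — the operator of the displayed equation
L823–829. [cite: Dimock2013BalabanII, Lemma 2.3 (eddie1) L754–756 and proof L823–829 (arXiv:1212.5562v2 TeX)] -/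
theorem gInvO_next :
    gInvO D (weightO (aNext ak aL) aτ) (rowsO (Q * Qk) Qτ) = (D + restE aτ Qτ) + aNext ak aL • ((Q * Qk)ᵀ * (Q * Qk)) :=
  gInvO_block

omit [DecidableEq ι] in
/-- `φ⁰_{k+1,Ω⁺}` solves *"(−Δ + μ̄_k + Σ_j[Q_jᵀa^{(k)}_jQ_j]_{δΩ_j} + L^{−2}[Qᵀ_{k+1}a_{k+1}Q_{k+1}]_{Ω_{k+1}})φ = Σ_j a^{(k)}_j
Q_jᵀΦ_{j,δΩ_j} + L^{−2}a_{k+1}Qᵀ_{k+1}Φ_{k+1} + [Δ]_{Ω₁,Ω₁ᶜ}φ_{Ω₁ᶜ}"* (`D > 0`, `𝐚_τ ≥ 0`, `a_k > 0`, `aL ≥ 0`).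
[cite: Dimock2013BalabanII, Lemma 2.3 proof L823–831 (arXiv:1212.5562v2 TeX)] -/
theorem phi0_eq (hD : D.PosDef) (haτ : aτ.PosSemidef) (hak : 0 < ak) (haL : 0 ≤ aL) (Φ' : σ → ℝ) (Φτ : τ → ℝ)
    (src : κ → ℝ) :
    ((D + restE aτ Qτ) + aNext ak aL • ((Q * Qk)ᵀ * (Q * Qk))) *ᵥ phi0 D ak aτ Qk Qτ Q aL Φ' Φτ src
      = (Q * Qk)ᵀ *ᵥ (aNext ak aL • Φ') + Qτᵀ *ᵥ (aτ *ᵥ Φτ) + src := by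
  have h := variational_eq (Qm := rowsO (Q * Qk) Qτ) hD (weightO_posSemidef (ι := σ) (aNext_nonneg hak haL) haτ)
    (Sum.elim Φ' Φτ) src
  rw [gInvO_next] at h
  unfold phi0
  rw [h]
  unfold weightO rowsO
  rw [transpose_fromRows, fromBlocks_mulVec, fromCols_mulVec_sumElim]
  simp only [Sum.elim_comp_inl, Sum.elim_comp_inr, zero_mulVec, add_zero, zero_add, smul_mulVec, one_mulVec]

omit [DecidableEq κ] in
/-- **THE DECOMPOSITION behind Lemma 2.3**: `J = E′(φ) + ½⟨Φ_{k,Ω_{k+1}} − Ψ_k(Φ_{k+1}, φ), (a_k + aL·QᵀQ)(…)⟩` — split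
`½‖𝐚^{1/2}(Φ_{k,Ω} − Q_{k,Ω}φ)‖²` into the `Ω_{k+1}` piece and the rest (L840–843) and combine the first two terms by
(stringy2) (L856–857 *"However just as in (stringy2) the first two terms combine to give ½a_{k+1}L^{−2}‖Φ_{k+1} −
Q_{k+1}φ‖²"*). [cite: Dimock2013BalabanII, Lemma 2.3 proof L840–867 (arXiv:1212.5562v2 TeX)] -/
theorem J_eq (hQ : Q * Qᵀ = 1) (h : ak + aL ≠ 0) (Φ' : σ → ℝ) (Φτ : τ → ℝ) (src : κ → ℝ)
    (Φι : ι → ℝ) (φ : κ → ℝ) :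
    J D ak aτ Qk Qτ Q aL Φ' Φτ src Φι φ
      = energyNext D ak aτ Qk Qτ Q aL Φ' Φτ src φ
        + (1 / 2) * ((Φι - Psi Qk Q ak aL Φ' φ) ⬝ᵥ (oneStepH Q ak aL *ᵥ (Φι - Psi Qk Q ak aL Φ' φ))) := by
  unfold J energyNext
  rw [energy_block, energy_block, ← mulVec_mulVec]
  have hs := stringy_eq (Qk := Qk) hQ h Φ' φ Φι
  unfold stringy at hs
  linarith

/-- **LEMMA 2.3, part 1 — the joint minimum** (eddie)/(eddie2): at `φ_{Ω₁} = φ⁰_{k+1,Ω⁺}` and `Φ_{k,Ω_{k+1}} =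
Ψ_{k,Ω_{k+1}}(Ω⁺) = Ψ_k(Φ_{k+1}, φ⁰_{k+1,Ω⁺})` the functional `J_{Ω⁺}` is `≤` its value at every `(Φ_{k,Ω_{k+1}}, φ_{Ω₁})`.
[cite: Dimock2013BalabanII, Lemma 2.3 part 1 L741–760, proof L796–834 (arXiv:1212.5562v2 TeX)] -/
theorem J_joint_min (hD : D.PosDef) (haτ : aτ.PosSemidef) (hQ : Q * Qᵀ = 1) (hak : 0 < ak)
    (haL : 0 ≤ aL) (Φ' : σ → ℝ) (Φτ : τ → ℝ) (src : κ → ℝ) (Φι : ι → ℝ) (φ : κ → ℝ) :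
    J D ak aτ Qk Qτ Q aL Φ' Φτ src (Psi Qk Q ak aL Φ' (phi0 D ak aτ Qk Qτ Q aL Φ' Φτ src))
        (phi0 D ak aτ Qk Qτ Q aL Φ' Φτ src)
      ≤ J D ak aτ Qk Qτ Q aL Φ' Φτ src Φι φ := by
  have h : ak + aL ≠ 0 := by linarith
  rw [J_eq hQ h, J_eq hQ h, sub_self, mulVec_zero, dotProduct_zero, mul_zero, add_zero]
  have h1 := energy_minimizer_le (Qm := rowsO (Q * Qk) Qτ) hD
    (weightO_posSemidef (ι := σ) (aNext_nonneg hak haL) haτ) (Sum.elim Φ' Φτ) src φ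
  have h2 : 0 ≤ (Φι - Psi Qk Q ak aL Φ' φ) ⬝ᵥ (oneStepH Q ak aL *ᵥ (Φι - Psi Qk Q ak aL Φ' φ)) := by
    have := (oneStepH_posDef (Q := Q) hak haL).posSemidef.dotProduct_mulVec_nonneg (Φι - Psi Qk Q ak aL Φ' φ)
    rwa [star_trivial] at this
  unfold energyNext phi0
  linarith

/-- **LEMMA 2.3, part 1 — uniqueness** (*"The unique minimum … comes at"*): the minimum value is attained at
`(Φ_{k,Ω_{k+1}}, φ_{Ω₁})` iff `φ_{Ω₁} = φ⁰_{k+1,Ω⁺}` and `Φ_{k,Ω_{k+1}} = Ψ_k(Φ_{k+1}, φ_{Ω₁})`.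
[cite: Dimock2013BalabanII, Lemma 2.3 part 1 L741–760, proof L796–834 (arXiv:1212.5562v2 TeX)] -/
theorem J_eq_joint_min_iff (hD : D.PosDef) (haτ : aτ.PosSemidef) (hQ : Q * Qᵀ = 1) (hak : 0 < ak)
    (haL : 0 ≤ aL) (Φ' : σ → ℝ) (Φτ : τ → ℝ) (src : κ → ℝ) (Φι : ι → ℝ) (φ : κ → ℝ) :
    J D ak aτ Qk Qτ Q aL Φ' Φτ src Φι φ
        = J D ak aτ Qk Qτ Q aL Φ' Φτ src (Psi Qk Q ak aL Φ' (phi0 D ak aτ Qk Qτ Q aL Φ' Φτ src))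
            (phi0 D ak aτ Qk Qτ Q aL Φ' Φτ src)
      ↔ φ = phi0 D ak aτ Qk Qτ Q aL Φ' Φτ src ∧ Φι = Psi Qk Q ak aL Φ' φ := by
  have h : ak + aL ≠ 0 := by linarith
  have hW := weightO_posSemidef (ι := σ) (aNext_nonneg hak haL) haτ
  constructor
  · intro hJ
    rw [J_eq hQ h, J_eq hQ h, sub_self, mulVec_zero, dotProduct_zero, mul_zero, add_zero] at hJ
    unfold energyNext phi0 at hJ
    unfold phi0
    have h1 := energy_minimizer_le (Qm := rowsO (Q * Qk) Qτ) hD hW (Sum.elim Φ' Φτ) src φ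
    have h2 : 0 ≤ (Φι - Psi Qk Q ak aL Φ' φ) ⬝ᵥ (oneStepH Q ak aL *ᵥ (Φι - Psi Qk Q ak aL Φ' φ)) := by
      have := (oneStepH_posDef (Q := Q) hak haL).posSemidef.dotProduct_mulVec_nonneg (Φι - Psi Qk Q ak aL Φ' φ)
      rwa [star_trivial] at this
    have hφ : φ = minimizer D (weightO (aNext ak aL) aτ) (rowsO (Q * Qk) Qτ) (Sum.elim Φ' Φτ) src := by
      by_contra hne
      have h3 := energy_minimizer_lt (Qm := rowsO (Q * Qk) Qτ) hD hW (Sum.elim Φ' Φτ) src hne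
      linarith
    refine ⟨hφ, ?_⟩
    have h4 : (Φι - Psi Qk Q ak aL Φ' φ) ⬝ᵥ (oneStepH Q ak aL *ᵥ (Φι - Psi Qk Q ak aL Φ' φ)) = 0 := by
      rw [← hφ] at hJ
      linarith
    by_contra hne
    have h5 := (oneStepH_posDef (Q := Q) hak haL).dotProduct_mulVec_pos (sub_ne_zero.mpr hne)
    rw [star_trivial] at h5
    linarith
  · rintro ⟨hφ, hΦ⟩
    rw [hΦ, hφ]

/-- **LEMMA 2.3, part 2 (loopy)**: `φ⁰_{k+1,Ω⁺} = φ_{k,Ω}(φ_{Ω₁ᶜ}, Ψ_{k,Ω⁺})` — the next-level minimizer is the level-`k`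
minimizer (unknown) at `Φ_{k,Ω_{k+1}} = Ψ_{k,Ω_{k+1}}(Ω⁺)` (*"Replace Φ_{k,Ω} by Ψ_{k,Ω⁺} in the second equation in
(cherry) and solve for φ"*; `QQᵀ = I` is not needed for this part). [cite: Dimock2013BalabanII, Lemma 2.3 part 2 (loopy) L762–774, proof L836–838
(arXiv:1212.5562v2 TeX)] -/
theorem minimizer_Psi_phi0 (hD : D.PosDef) (haτ : aτ.PosSemidef) (hak : 0 < ak) (haL : 0 ≤ aL) (Φ' : σ → ℝ)
    (Φτ : τ → ℝ) (src : κ → ℝ) :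
    minimizer D (weightO ak aτ) (rowsO Qk Qτ)
        (Sum.elim (Psi Qk Q ak aL Φ' (phi0 D ak aτ Qk Qτ Q aL Φ' Φτ src)) Φτ) src
      = phi0 D ak aτ Qk Qτ Q aL Φ' Φτ src := by
  have h : ak + aL ≠ 0 := by linarith
  set φ₀ := phi0 D ak aτ Qk Qτ Q aL Φ' Φτ src with hφ₀
  set w : σ → ℝ := Φ' - Q *ᵥ (Qk *ᵥ φ₀) with hw
  symm
  apply eq_minimizer_of_variational_eq hD (weightO_posSemidef (ι := ι) hak.le haτ)
  -- the level-k variational equation at Φ_{k,Ω_{k+1}} = Ψ: left side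
  rw [gInvO_block, add_mulVec, smul_mulVec, ← mulVec_mulVec]
  -- right side
  unfold weightO rowsO
  rw [transpose_fromRows, fromBlocks_mulVec, fromCols_mulVec_sumElim]
  simp only [Sum.elim_comp_inl, Sum.elim_comp_inr, zero_mulVec, add_zero, zero_add, smul_mulVec, one_mulVec,
    mulVec_smul]
  -- the next-level equation for φ⁰ (L823–829) and Ψ − Q_kφ⁰ = c Qᵀw, a_k c = a′
  have h0 : ((D + restE aτ Qτ) + aNext ak aL • ((Q * Qk)ᵀ * (Q * Qk))) *ᵥ phi0 D ak aτ Qk Qτ Q aL Φ' Φτ src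
      = (Q * Qk)ᵀ *ᵥ (aNext ak aL • Φ') + Qτᵀ *ᵥ (aτ *ᵥ Φτ) + src := phi0_eq hD haτ hak haL Φ' Φτ src
  rw [← hφ₀, add_mulVec, smul_mulVec, transpose_mul] at h0
  simp only [← mulVec_mulVec, mulVec_smul] at h0
  have hΨ : Psi Qk Q ak aL Φ' φ₀ = Qk *ᵥ φ₀ + (aL / (ak + aL)) • (Qᵀ *ᵥ w) := by
    rw [← Psi_sub Φ' φ₀]
    abel
  have hc : ak * (aL / (ak + aL)) = aNext ak aL := by
    unfold aNext
    field_simp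
  have hD0 : (D + restE aτ Qτ) *ᵥ φ₀
      = aNext ak aL • (Qkᵀ *ᵥ (Qᵀ *ᵥ Φ')) + Qτᵀ *ᵥ (aτ *ᵥ Φτ) + src
        - aNext ak aL • (Qkᵀ *ᵥ (Qᵀ *ᵥ (Q *ᵥ (Qk *ᵥ φ₀)))) := by
    rw [← h0]
    abel
  rw [hD0, hΨ, mulVec_add, mulVec_smul, smul_add, smul_smul, hc, hw, mulVec_sub, mulVec_sub, smul_sub]
  abel

/-- **LEMMA 2.3, part 3 (nono)**: the value of `J_{Ω⁺}` at the minimizer is `E′(φ⁰_{k+1,Ω⁺})` = (nono) (its first two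
displayed terms being the dropped `φ_{Ω₁ᶜ}`-constant and `−⟨φ⁰, src⟩`, the third `S⁰_{k+1}(Ω₁, Φ_{k+1,Ω⁺}, φ⁰)`).
[cite: Dimock2013BalabanII, Lemma 2.3 part 3 (nono) L775–791, proof (stung) L840–867 (arXiv:1212.5562v2 TeX)] -/
theorem J_at_min (hQ : Q * Qᵀ = 1) (h : ak + aL ≠ 0) (Φ' : σ → ℝ) (Φτ : τ → ℝ) (src : κ → ℝ) :
    J D ak aτ Qk Qτ Q aL Φ' Φτ src (Psi Qk Q ak aL Φ' (phi0 D ak aτ Qk Qτ Q aL Φ' Φτ src))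
        (phi0 D ak aτ Qk Qτ Q aL Φ' Φτ src)
      = energyNext D ak aτ Qk Qτ Q aL Φ' Φτ src (phi0 D ak aτ Qk Qτ Q aL Φ' Φτ src) := by
  rw [J_eq hQ h, sub_self, mulVec_zero, dotProduct_zero, mul_zero, add_zero]

/-! ## §4 The expansion (expand)/(worry) and its link to App. C -/

/-- `𝒵_{k,Ω} := φ_{k,Ω}(0, Z)` for `Z : Ω^{(k)}_{k+1} → ℝ` — the level-`k` minimizer at `Φ_{k,Ω} = (0, Z)`, no boundary
source. [cite: Dimock2013BalabanII, §2.3 L874–884 (arXiv:1212.5562v2 TeX)] -/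
noncomputable def calZ (D : Matrix κ κ ℝ) (ak : ℝ) (aτ : Matrix τ τ ℝ) (Qk : Matrix ι κ ℝ) (Qτ : Matrix τ κ ℝ)
    (Z : ι → ℝ) : κ → ℝ :=
  minimizer D (weightO ak aτ) (rowsO Qk Qτ) (Sum.elim Z 0) 0

omit [Fintype σ] [DecidableEq σ] in
/-- *"𝒵_{k,Ω} = φ_{k,Ω}(0,Z) = a_kG_{k,Ω}Q_kᵀZ"*. [cite: Dimock2013BalabanII, §2.3 L884 (arXiv:1212.5562v2 TeX)] -/
theorem calZ_eq (Z : ι → ℝ) :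
    calZ D ak aτ Qk Qτ Z = ak • (GkO D (weightO ak aτ) (rowsO Qk Qτ) *ᵥ (Qkᵀ *ᵥ Z)) := by
  unfold calZ minimizer weightO rowsO
  rw [transpose_fromRows, fromBlocks_mulVec, fromCols_mulVec_sumElim]
  simp only [Sum.elim_comp_inl, Sum.elim_comp_inr, mulVec_zero, zero_mulVec, add_zero, smul_mulVec, one_mulVec,
    mulVec_smul]

omit [Fintype κ] [Fintype ι] [Fintype σ] [Fintype τ] [DecidableEq κ] [DecidableEq ι] [DecidableEq σ] in
/-- `(Φ + Z, Φ_τ) = (Φ, Φ_τ) + (Z, 0)` componentwise. [folklore] -/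
private theorem sumElim_add_inl (Φι Z : ι → ℝ) (Φτ : τ → ℝ) :
    Sum.elim (Φι + Z) Φτ = Sum.elim Φι Φτ + Sum.elim Z 0 := by
  ext (i | i)
  · rfl
  · simp

omit [Fintype σ] [DecidableEq σ] in
/-- the minimizer is linear in its data: *"φ_{k,Ω}(φ_{Ω₁ᶜ}, Ψ_{k,Ω⁺} + (0,Z)) = φ_{k,Ω}(φ_{Ω₁ᶜ}, Ψ_{k,Ω⁺}) + a_kG_{k,Ω}Q_kᵀZ"*.
[cite: Dimock2013BalabanII, §2.3 L874–884 (arXiv:1212.5562v2 TeX)] -/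
theorem minimizer_inl_add (Φι Z : ι → ℝ) (Φτ : τ → ℝ) (src : κ → ℝ) :
    minimizer D (weightO ak aτ) (rowsO Qk Qτ) (Sum.elim (Φι + Z) Φτ) src
      = minimizer D (weightO ak aτ) (rowsO Qk Qτ) (Sum.elim Φι Φτ) src + calZ D ak aτ Qk Qτ Z := by
  unfold calZ minimizer
  rw [sumElim_add_inl, mulVec_add (weightO ak aτ), mulVec_add (rowsO Qk Qτ)ᵀ, add_zero,
    ← mulVec_add (GkO D (weightO ak aτ) (rowsO Qk Qτ))]
  congr 1
  abel

omit [DecidableEq κ] [DecidableEq ι] [DecidableEq σ] in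
/-- `Ψ_k` is affine in `φ`: `Ψ_k(Φ_{k+1}, φ + 𝒵) = Ψ_k(Φ_{k+1}, φ) + Ψ_k(0, 𝒵)`. [cite: Dimock2013BalabanII, §2.1 (psik)
L520–524 (arXiv:1212.5562v2 TeX)] -/
theorem Psi_add (Φ' : σ → ℝ) (φ calZ' : κ → ℝ) :
    Psi Qk Q ak aL Φ' (φ + calZ') = Psi Qk Q ak aL Φ' φ + Psi Qk Q ak aL 0 calZ' := by
  unfold Psi
  rw [mulVec_add, mulVec_add, mulVec_add, smul_add, mulVec_zero, smul_zero, add_zero]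
  abel

omit [DecidableEq κ] [DecidableEq ι] [DecidableEq σ] in
/-- the exponent at zero data is the bare quadratic form: `E(0, 0; φ) = ½⟨φ, (D + Qᵀ𝐚Q)φ⟩`. [folklore] -/
private theorem energy_zero_data {m : Type*} [Fintype m] {a : Matrix m m ℝ} (has : aᵀ = a) (Qm : Matrix m κ ℝ)
    (φ : κ → ℝ) :
    energy D a Qm 0 0 φ = (1 / 2) * (φ ⬝ᵥ (gInvO D a Qm *ᵥ φ)) := by
  unfold energy
  rw [action_eq_sun2 has, mulVec_zero, mulVec_zero, dotProduct_zero, zero_dotProduct, dotProduct_zero]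
  ring

omit [DecidableEq σ] in
/-- **(worry)**: the quadratic terms in `Z` are `(a/2L²)‖QZ‖² + S_k(Ω₁, (0,Z), 𝒵_{k,Ω}) = (a/2L²)‖QZ‖² + ½(Z,
[Δ_{k,Ω}]_{Ω_{k+1}}Z)` (*"The second form follows from (ping)"* = `MultiRegionFreeFlow.action_minimizer` at zero source):
in the model, `J` at zero data `(Φ_{k+1}, Φ_τ, src) = 0` evaluated at `(Z, 𝒵_{k,Ω})`.
[cite: Dimock2013BalabanII, §2.3 (worry) L896–909 (arXiv:1212.5562v2 TeX)] -/
theorem quadratic_terms (hD : D.PosDef) (haτ : aτ.PosSemidef) (hak : 0 ≤ ak) (Z : ι → ℝ) :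
    J D ak aτ Qk Qτ Q aL 0 0 0 Z (calZ D ak aτ Qk Qτ Z)
      = (aL / 2) * ((Q *ᵥ Z) ⬝ᵥ (Q *ᵥ Z))
        + (1 / 2) * (Z ⬝ᵥ ((DeltakO D (weightO ak aτ) (rowsO Qk Qτ)).toBlocks₁₁ *ᵥ Z)) := by
  unfold J energy calZ
  rw [action_minimizer hD (weightO_posSemidef (ι := ι) hak haτ), sumElim_zero_dot_mulVec, dotProduct_zero,
    zero_dotProduct, mul_zero, add_zero, sub_zero, zero_sub, neg_dotProduct, dotProduct_neg, neg_neg]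

/-- **THE EXPANSION (expand)**: `J_{Ω⁺}(Φ_{k+1}, Ψ_{k,Ω⁺} + (0,Z), φ⁰_{k+1,Ω⁺} + 𝒵_{k,Ω}) = J_min + ½(Z, [Δ_{k,Ω} +
(a/L²)QᵀQ]_{Ω_{k+1}}Z)` — *"That the first three terms are the value at Z = 0 follows from the previous lemma. The
linear terms must vanish"* (here: automatically, `φ⁰` being the minimizer of `E′` and `Ψ_k` affine) *". Thus we only
have to look at the quadratic terms"* (= `quadratic_terms`).  (`D > 0`, `𝐚_τ ≥ 0`, `QQᵀ = I`, `a_k > 0`, `aL ≥ 0`.)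
[cite: Dimock2013BalabanII, §2.3 (expand) L886–909 (arXiv:1212.5562v2 TeX)] -/
theorem J_expand (hD : D.PosDef) (haτ : aτ.PosSemidef) (hQ : Q * Qᵀ = 1) (hak : 0 < ak)
    (haL : 0 ≤ aL) (Φ' : σ → ℝ) (Φτ : τ → ℝ) (src : κ → ℝ) (Z : ι → ℝ) :
    J D ak aτ Qk Qτ Q aL Φ' Φτ src (Psi Qk Q ak aL Φ' (phi0 D ak aτ Qk Qτ Q aL Φ' Φτ src) + Z)
        (phi0 D ak aτ Qk Qτ Q aL Φ' Φτ src + calZ D ak aτ Qk Qτ Z)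
      = J D ak aτ Qk Qτ Q aL Φ' Φτ src (Psi Qk Q ak aL Φ' (phi0 D ak aτ Qk Qτ Q aL Φ' Φτ src))
          (phi0 D ak aτ Qk Qτ Q aL Φ' Φτ src)
        + (1 / 2) * (Z ⬝ᵥ (((DeltakO D (weightO ak aτ) (rowsO Qk Qτ)).toBlocks₁₁ + aL • proj Q) *ᵥ Z)) := by
  have h : ak + aL ≠ 0 := by linarith
  have hW := weightO_posSemidef (ι := σ) (aNext_nonneg hak haL) haτ
  have hWs : (weightO (ι := σ) (aNext ak aL) aτ)ᵀ = weightO (aNext ak aL) aτ := by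
    have := hW.isHermitian
    rwa [IsHermitian, conjTranspose_eq_transpose_of_trivial] at this
  set φ₀ := phi0 D ak aτ Qk Qτ Q aL Φ' Φτ src with hφ₀
  set cZ := calZ D ak aτ Qk Qτ Z with hcZ
  -- decompose both sides (Lemma 2.3's J = E′ + ½ h)
  rw [J_eq hQ h, J_eq hQ h, sub_self, mulVec_zero, dotProduct_zero, mul_zero, add_zero, Psi_add]
  have hsimp : Psi Qk Q ak aL Φ' φ₀ + Z - (Psi Qk Q ak aL Φ' φ₀ + Psi Qk Q ak aL 0 cZ) = Z - Psi Qk Q ak aL 0 cZ := by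
    abel
  rw [hsimp]
  -- E′(φ⁰ + 𝒵) = E′(φ⁰) + ½⟨𝒵, G⁰⁻¹ 𝒵⟩: no linear term since φ⁰ is E′'s minimizer
  have hE : energyNext D ak aτ Qk Qτ Q aL Φ' Φτ src (φ₀ + cZ)
      = energyNext D ak aτ Qk Qτ Q aL Φ' Φτ src φ₀
        + (1 / 2) * (cZ ⬝ᵥ (gInvO D (weightO (aNext ak aL) aτ) (rowsO (Q * Qk) Qτ) *ᵥ cZ)) := by
    unfold energyNext
    rw [hφ₀]
    exact energy_minimizer_add hD hW (Sum.elim Φ' Φτ) src cZ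
  -- the quadratic terms: the decomposition at ZERO data, evaluated at (Z, 𝒵), is (worry)
  have hq := J_eq (D := D) (aτ := aτ) (Qk := Qk) (Qτ := Qτ) hQ h 0 0 0 Z cZ
  rw [quadratic_terms hD haτ hak.le] at hq
  have hE0 : energyNext D ak aτ Qk Qτ Q aL 0 0 0 cZ
      = (1 / 2) * (cZ ⬝ᵥ (gInvO D (weightO (aNext ak aL) aτ) (rowsO (Q * Qk) Qτ) *ᵥ cZ)) := by
    unfold energyNext
    have h00 : (Sum.elim (0 : σ → ℝ) (0 : τ → ℝ)) = 0 := by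
      ext (i | i) <;> rfl
    rw [h00]
    exact energy_zero_data hWs _ cZ
  have hB : Z ⬝ᵥ (((DeltakO D (weightO ak aτ) (rowsO Qk Qτ)).toBlocks₁₁ + aL • proj Q) *ᵥ Z)
      = Z ⬝ᵥ ((DeltakO D (weightO ak aτ) (rowsO Qk Qτ)).toBlocks₁₁ *ᵥ Z) + aL * ((Q *ᵥ Z) ⬝ᵥ (Q *ᵥ Z)) := by
    rw [add_mulVec, dotProduct_add, smul_mulVec, dotProduct_smul, dot_proj_mulVec, smul_eq_mul]
  rw [hE, hB]
  linarith

/-- … and the quadratic form of (expand) is the INVERSE of App. C's fluctuation covariance `C_{k,Ω⁺,r}` at `r = 0`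
(`MultiRegionFreeFlow.CkOr … aL 0`): the `Z`-integral (cloudy3) is the Gaussian whose covariance the lemma (z4)
represents. [cite: Dimock2013BalabanII, §2.3 (cloudy3) L911–918 and App. C L6578–6581 (arXiv:1212.5562v2 TeX)] -/
theorem bracket_mul_CkOr (hD : D.PosDef) (haτ : aτ.PosSemidef) (hQ : Q * Qᵀ = 1) (hak : 0 < ak)
    (haL : 0 ≤ aL) :
    ((DeltakO D (weightO ak aτ) (rowsO Qk Qτ)).toBlocks₁₁ + aL • proj Q) * CkOr D ak aτ Qk Qτ Q aL 0 = 1 := by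
  have h := CkOr_mul_eq_one (Qk := Qk) (Qτ := Qτ) hD haτ hQ hak haL le_rfl
  rw [zero_smul, add_zero] at h
  exact mul_eq_one_comm.mp h

end Otto

/-! ## §5 Non-vacuity: one-site instances -/

/-- (stringy2) on one site per lattice (`Q_k = Q = 1`, `a_k = aL = 1`, so `a′ = ½`, `Ψ = ½(φ + Φ')`). -/
example (Φ' : Unit → ℝ) (φ : Unit → ℝ) :
    stringy (1 : Matrix Unit Unit ℝ) (1 : Matrix Unit Unit ℝ) 1 1 Φ' φ (Psi (1 : Matrix Unit Unit ℝ) 1 1 1 Φ' φ)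
      = (aNext 1 1 / 2) * ((Φ' - (1 : Matrix Unit Unit ℝ) *ᵥ ((1 : Matrix Unit Unit ℝ) *ᵥ φ)) ⬝ᵥ
          (Φ' - (1 : Matrix Unit Unit ℝ) *ᵥ ((1 : Matrix Unit Unit ℝ) *ᵥ φ))) :=
  stringy_Psi (by simp) (by norm_num) Φ' φ

/-- Lemma 2.3 part 2 (loopy) on one site per lattice: every hypothesis met with `D = 𝐚_τ = Q_k = Q_τ = Q = 1`,
`a_k = aL = 1`. -/
example (Φ' Φτ src : Unit → ℝ) :
    minimizer (1 : Matrix Unit Unit ℝ) (weightO 1 (1 : Matrix Unit Unit ℝ))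
        (rowsO (1 : Matrix Unit Unit ℝ) (1 : Matrix Unit Unit ℝ))
        (Sum.elim (Psi (1 : Matrix Unit Unit ℝ) (1 : Matrix Unit Unit ℝ) 1 1 Φ'
          (phi0 (1 : Matrix Unit Unit ℝ) 1 (1 : Matrix Unit Unit ℝ) (1 : Matrix Unit Unit ℝ) (1 : Matrix Unit Unit ℝ)
            (1 : Matrix Unit Unit ℝ) 1 Φ' Φτ src)) Φτ) src
      = phi0 (1 : Matrix Unit Unit ℝ) 1 (1 : Matrix Unit Unit ℝ) (1 : Matrix Unit Unit ℝ) (1 : Matrix Unit Unit ℝ)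
          (1 : Matrix Unit Unit ℝ) 1 Φ' Φτ src :=
  minimizer_Psi_phi0 Matrix.PosDef.one Matrix.PosSemidef.one one_pos zero_le_one Φ' Φτ src

end Literature.MathematicalPhysics.QuantumFieldTheory.Dimock2011to13.FreeFlowSingleStep
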